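import Mathlib
import Literature.Analysis.FluidPDE.ClassicalSolution
import Literature.Analysis.FluidPDE.ClassicalSolutionCalculus
import Summits.NavierStokesRegularity.NavierStokesRegularity.Theorems.PlaneEnergyCeilingSlabEnergyIdentityPointwise
import Summits.NavierStokesRegularity.NavierStokesRegularity.Theorems.PlaneEnergyCeilingPlanarEnergyAPrioriSlabLawDecay
import Summits.NavierStokesRegularity.NavierStokesRegularity.Theorems.PlaneEnergyCeilingPlanarEnergyAPrioriWeightedEnergyTime

/-!
# Route PlaneEnergyCeiling · crux `PlanarEnergyAPriori` — toward the signed flux ledger: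
# the tendency field along a classical solution and the time-integrated weighted energy

Helper file for the crux item stmt-NavierStokesRegularity-16855 (`PlanarEnergyAPriori`, route
`PlaneEnergyCeiling`), landed `--supports` that item. The route's TWO-LAYER PLAN names the
SIGNED FLUX LEDGER (`|∫ F_ℓ dt| ≤ E₀(2 + cνΔt/ℓ²)` for the `ℓ`-smoothed Bernoulli flux) as the first
child of the open stub `stub_fluxConvergenceBudget`. Its engine is the weighted energy identity
(seat 3, `weightedEnergyIdentity`) integrated in time; this file supplies the time side:

* `timeDerivWithin_eq_acc` — along a classical solution of unforced Navier–Stokes the time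
  derivative is the tendency field `acc = νΔu − (u·∇)u − ∇p`;
* `norm_acc_le_weight` — under order-(3,2) decay, `‖acc‖ ≤ (3νC + C² + C)(1+‖x‖)⁻²`, and
  `norm_weight_mul_two_inner_acc_le` — `|g(x₂)·2⟪acc, u⟫| ≤ 2KC(3νC + C² + C)(1+‖x‖)⁻⁵` for a
  weight `|g| ≤ K`;
* `integral_Ioo_integral_weight_mul_two_inner_acc` — THE TIME-INTEGRATED WEIGHTED ENERGY along a
  classical solution on `[0,t]` with order-(3,2) decay and a bounded continuous weight `g` of the
  height: `∫_{(s₁,s₂)} ∫ g(x₂)·2⟪acc, u⟫ dx ds = ∫ g|u(s₂)|² − ∫ g|u(s₁)|²`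
  (`weightedEnergy_timeIntegration`, landed, with the `(1+‖x‖)⁻⁵` majorant).

Folklore calculus (Caffarelli–Kohn–Nirenberg 1982 §2 bookkeeping); Mathlib + the route's helper
files.
-/

noncomputable section

-- single-conjunct summit: `Summit.<Summit>.<Problem>` repeats the name by the D-0017 layout
set_option linter.dupNamespace false

namespace Summit.NavierStokesRegularity.NavierStokesRegularity.Theorems.PlanarEnergyAPriori

open MeasureTheory Set Filter Topology Function WithLp
open scoped ENNReal RealInnerProductSpace Laplacian
open Literature.Analysis.FluidPDE
open Summit.NavierStokesRegularity.NavierStokesRegularity.Theorems.PlaneEnergyCeilingSlabEnergyIdentity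
open Summit.NavierStokesRegularity.NavierStokesRegularity.Theorems.PlanarEnergyAPriori.SlabLaw

/-! ### The tendency field along a classical solution -/

/-- **Momentum equation, solved for the time derivative.** Along a classical solution of the
UNFORCED Navier–Stokes system on the time set `S`, for `s ∈ S`:
`∂ₜu(s,x) = νΔu(s)(x) − (u(s)·∇)u(s)(x) − ∇p(s)(x)` (the tendency field `acc`). -/
theorem timeDerivWithin_eq_acc {S : Set ℝ} {ν : ℝ}
    {u : ℝ → EuclideanSpace ℝ (Fin 3) → EuclideanSpace ℝ (Fin 3)} {p : ℝ → EuclideanSpace ℝ (Fin 3) → ℝ}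
    (h : IsClassicalNSSolutionOn S ν 0 u p) {s : ℝ} (hs : s ∈ S) (x : EuclideanSpace ℝ (Fin 3)) :
    timeDerivWithin S u s x = ν • Δ (u s) x - convect (u s) (u s) x - gradient (p s) x := by
  have hm := h.momentum s hs x
  simp only [Pi.zero_apply, add_zero] at hm
  calc timeDerivWithin S u s x
      = (timeDerivWithin S u s x + convect (u s) (u s) x) - convect (u s) (u s) x := by abel
    _ = (ν • Δ (u s) x - gradient (p s) x) - convect (u s) (u s) x := by rw [hm]
    _ = ν • Δ (u s) x - convect (u s) (u s) x - gradient (p s) x := by abel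

/-! ### The tendency field under order-(3,2) decay -/

section Decay

variable {u : EuclideanSpace ℝ (Fin 3) → EuclideanSpace ℝ (Fin 3)} {p : EuclideanSpace ℝ (Fin 3) → ℝ} {C ν : ℝ}
  {x : EuclideanSpace ℝ (Fin 3)}

/-- The Laplacian is dominated by the full second derivative: `‖Δu(x)‖ ≤ 3‖D²u(x)‖`
(`Δu = Σⱼ D²u(eⱼ,eⱼ)`). -/
theorem norm_laplacian_le (u : EuclideanSpace ℝ (Fin 3) → EuclideanSpace ℝ (Fin 3)) (x : EuclideanSpace ℝ (Fin 3)) :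
    ‖Δ u x‖ ≤ 3 * ‖iteratedFDeriv ℝ 2 u x‖ := by
  rw [laplacian_eq_sum_single u x]
  calc ‖∑ j : Fin 3, iteratedFDeriv ℝ 2 u x ![EuclideanSpace.single j 1, EuclideanSpace.single j 1]‖
      ≤ ∑ j : Fin 3, ‖iteratedFDeriv ℝ 2 u x ![EuclideanSpace.single j 1, EuclideanSpace.single j 1]‖ :=
        norm_sum_le _ _
    _ ≤ ∑ _j : Fin 3, ‖iteratedFDeriv ℝ 2 u x‖ :=
        Finset.sum_le_sum fun j _ => norm_iteratedFDeriv_two_single_le u x j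
    _ = 3 * ‖iteratedFDeriv ℝ 2 u x‖ := by simp [Finset.sum_const]

/-- **The tendency field decays like `(1+‖x‖)⁻²`.** Under order-(3,2) decay (`C ≥ 0`, `ν ≥ 0`):
`‖νΔu − (u·∇)u − ∇p‖ ≤ (3νC + C² + C)(1+‖x‖)⁻²`. -/
theorem norm_acc_le_weight (hν : 0 ≤ ν) (hC : 0 ≤ C) (h0 : ‖u x‖ ≤ C * (1 + ‖x‖) ^ (-(3 : ℝ)))
    (h1 : ‖fderiv ℝ u x‖ ≤ C * (1 + ‖x‖) ^ (-(3 : ℝ)))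
    (h2 : ‖iteratedFDeriv ℝ 2 u x‖ ≤ C * (1 + ‖x‖) ^ (-(3 : ℝ)))
    (k1 : ‖gradient p x‖ ≤ C * (1 + ‖x‖) ^ (-(2 : ℝ))) :
    ‖ν • Δ u x - convect u u x - gradient p x‖ ≤ (3 * ν * C + C ^ 2 + C) * (1 + ‖x‖) ^ (-(2 : ℝ)) := by
  set w2 : ℝ := (1 + ‖x‖) ^ (-(2 : ℝ)) with hw2
  set w3 : ℝ := (1 + ‖x‖) ^ (-(3 : ℝ)) with hw3
  have hw3pos : 0 < w3 := rpow_neg_pos x 3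
  have h32 : w3 ≤ w2 := rpow_neg_le_rpow_neg_of_le x (by norm_num)
  have hw31 : w3 ≤ 1 := rpow_neg_le_one x (by norm_num)
  -- the three terms
  have hL : ‖ν • Δ u x‖ ≤ 3 * ν * C * w2 := by
    rw [norm_smul, Real.norm_of_nonneg hν]
    calc ν * ‖Δ u x‖ ≤ ν * (3 * ‖iteratedFDeriv ℝ 2 u x‖) :=
          mul_le_mul_of_nonneg_left (norm_laplacian_le u x) hν
      _ ≤ ν * (3 * (C * w3)) := by gcongr
      _ ≤ ν * (3 * (C * w2)) := by gcongr
      _ = 3 * ν * C * w2 := by ring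
  have hN : ‖convect u u x‖ ≤ C ^ 2 * w2 := by
    unfold convect
    calc ‖fderiv ℝ u x (u x)‖ ≤ ‖fderiv ℝ u x‖ * ‖u x‖ := ContinuousLinearMap.le_opNorm _ _
      _ ≤ (C * w3) * (C * w3) := mul_le_mul h1 h0 (norm_nonneg _) (by positivity)
      _ = C ^ 2 * (w3 * w3) := by ring
      _ ≤ C ^ 2 * (w2 * 1) := by gcongr
      _ = C ^ 2 * w2 := by ring
  have hP : ‖gradient p x‖ ≤ C * w2 := k1
  calc ‖ν • Δ u x - convect u u x - gradient p x‖
      ≤ ‖ν • Δ u x‖ + ‖convect u u x‖ + ‖gradient p x‖ := norm_sub_le_of_le (norm_sub_le _ _) le_rfl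
    _ ≤ 3 * ν * C * w2 + C ^ 2 * w2 + C * w2 := by gcongr
    _ = (3 * ν * C + C ^ 2 + C) * w2 := by ring

/-- **The weighted tendency density decays like `(1+‖x‖)⁻⁵`**: for a weight `|g| ≤ K` of the
height, `|g(x₂)·2⟪acc, u⟫| ≤ 2KC(3νC + C² + C)(1+‖x‖)⁻⁵` under order-(3,2) decay. -/
theorem norm_weight_mul_two_inner_acc_le (hν : 0 ≤ ν) (hC : 0 ≤ C) (h0 : ‖u x‖ ≤ C * (1 + ‖x‖) ^ (-(3 : ℝ)))
    (h1 : ‖fderiv ℝ u x‖ ≤ C * (1 + ‖x‖) ^ (-(3 : ℝ)))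
    (h2 : ‖iteratedFDeriv ℝ 2 u x‖ ≤ C * (1 + ‖x‖) ^ (-(3 : ℝ)))
    (k1 : ‖gradient p x‖ ≤ C * (1 + ‖x‖) ^ (-(2 : ℝ))) {g : ℝ → ℝ} {K : ℝ} (hg : ∀ z, |g z| ≤ K) :
    ‖g (x 2) * (2 * ⟪ν • Δ u x - convect u u x - gradient p x, u x⟫)‖ ≤
      2 * K * C * (3 * ν * C + C ^ 2 + C) * (1 + ‖x‖) ^ (-(5 : ℝ)) := by
  have hK : 0 ≤ K := (abs_nonneg _).trans (hg 0)
  have hacc := norm_acc_le_weight hν hC h0 h1 h2 k1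
  have hA : 0 ≤ 3 * ν * C + C ^ 2 + C := by positivity
  rw [norm_mul, norm_mul, Real.norm_eq_abs, Real.norm_of_nonneg (zero_le_two), ← weight_two_mul_three]
  calc |g (x 2)| * (2 * ‖⟪ν • Δ u x - convect u u x - gradient p x, u x⟫‖)
      ≤ K * (2 * (‖ν • Δ u x - convect u u x - gradient p x‖ * ‖u x‖)) := by
        gcongr
        · exact hg _
        · exact norm_inner_le_norm _ _
    _ ≤ K * (2 * (((3 * ν * C + C ^ 2 + C) * (1 + ‖x‖) ^ (-(2 : ℝ))) * (C * (1 + ‖x‖) ^ (-(3 : ℝ))))) := by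
        gcongr
    _ = 2 * K * C * (3 * ν * C + C ^ 2 + C) * ((1 + ‖x‖) ^ (-(2 : ℝ)) * (1 + ‖x‖) ^ (-(3 : ℝ))) := by ring

end Decay

/-! ### The time-integrated weighted energy along a classical solution -/

/-- **Time-integrated weighted energy along a classical solution.** Let `(u,p)` be a classical
solution of unforced Navier–Stokes on `ℝ³ × [0,t]` (`t > 0`, `ν ≥ 0`) with ORDER-(3,2) DECAY on
`[0,t]`: `‖u‖, ‖Du‖, ‖D²u‖ ≤ C(1+‖x‖)⁻³` and `‖∇p‖ ≤ C(1+‖x‖)⁻²` at every time. Then for every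
bounded continuous weight `g` of the height and `0 ≤ s₁ ≤ s₂ ≤ t`:
`∫_{(s₁,s₂)} ∫ g(x₂)·2⟪νΔu − (u·∇)u − ∇p, u⟫ dx ds = ∫ g(x₂)|u(s₂)|² − ∫ g(x₂)|u(s₁)|²`
(the momentum equation inside the landed `weightedEnergy_timeIntegration`, dominated by
`(1+‖x‖)⁻⁵`). Combined with the weighted energy identity at each time this is the time-integrated
slab law behind the flux ledger and the mild slab law. [folklore] -/
theorem integral_Ioo_integral_weight_mul_two_inner_acc {ν t : ℝ} (hν : 0 ≤ ν) (ht : 0 < t)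
    {u : ℝ → EuclideanSpace ℝ (Fin 3) → EuclideanSpace ℝ (Fin 3)} {p : ℝ → EuclideanSpace ℝ (Fin 3) → ℝ}
    (hcl : IsClassicalNSSolutionOn (Icc 0 t) ν 0 u p) {C : ℝ}
    (h0 : ∀ s ∈ Icc 0 t, ∀ x, ‖u s x‖ ≤ C * (1 + ‖x‖) ^ (-(3 : ℝ)))
    (h1 : ∀ s ∈ Icc 0 t, ∀ x, ‖fderiv ℝ (u s) x‖ ≤ C * (1 + ‖x‖) ^ (-(3 : ℝ)))
    (h2 : ∀ s ∈ Icc 0 t, ∀ x, ‖iteratedFDeriv ℝ 2 (u s) x‖ ≤ C * (1 + ‖x‖) ^ (-(3 : ℝ)))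
    (k1 : ∀ s ∈ Icc 0 t, ∀ x, ‖gradient (p s) x‖ ≤ C * (1 + ‖x‖) ^ (-(2 : ℝ)))
    {g : ℝ → ℝ} (hg : Continuous g) {K : ℝ} (hgK : ∀ z, |g z| ≤ K)
    {s₁ s₂ : ℝ} (hs₁ : 0 ≤ s₁) (hs : s₁ ≤ s₂) (hs₂ : s₂ ≤ t) :
    ∫ s in Ioo s₁ s₂, ∫ x, g (x 2) * (2 * ⟪ν • Δ (u s) x - convect (u s) (u s) x - gradient (p s) x, u s x⟫) =
      (∫ x, g (x 2) * ‖u s₂ x‖ ^ 2) - ∫ x, g (x 2) * ‖u s₁ x‖ ^ 2 := by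
  have hC : 0 ≤ C := nonneg_of_norm_le_rpow (h0 s₁ ⟨hs₁, hs.trans hs₂⟩)
  have hK : 0 ≤ K := (abs_nonneg _).trans (hgK 0)
  have hsm := hcl.smooth_velocity
  -- the `(1+‖x‖)⁻⁵` majorant of the density, integrable on `ℝ³`
  set A : ℝ := 2 * K * C * (3 * ν * C + C ^ 2 + C) with hA
  have hA0 : 0 ≤ A := by positivity
  have hr : (Module.finrank ℝ (EuclideanSpace ℝ (Fin 3)) : ℝ) < 5 := by
    rw [finrank_euclideanSpace, Fintype.card_fin]; norm_num
  have hBint : Integrable fun x : EuclideanSpace ℝ (Fin 3) => A * (1 + ‖x‖) ^ (-(5 : ℝ)) :=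
    (integrable_one_add_norm hr).const_mul A
  have hBnn : ∀ x : EuclideanSpace ℝ (Fin 3), 0 ≤ A * (1 + ‖x‖) ^ (-(5 : ℝ)) := fun x =>
    mul_nonneg hA0 (rpow_neg_pos x 5).le
  -- pointwise domination of the density at the times of the solution
  have hdom : ∀ s ∈ Icc 0 t, ∀ x,
      ‖g (x 2) * (2 * ⟪timeDerivWithin (Icc 0 t) u s x, u s x⟫)‖ ≤ A * (1 + ‖x‖) ^ (-(5 : ℝ)) := by
    intro s hs' x
    rw [timeDerivWithin_eq_acc hcl hs' x, hA]
    exact norm_weight_mul_two_inner_acc_le hν hC (h0 s hs' x) (h1 s hs' x) (h2 s hs' x) (k1 s hs' x) hgK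
  -- the finite iterated `lintegral`
  have hfin : ∫⁻ τ in Ioo s₁ s₂, ∫⁻ x, ‖g (x 2) * (2 * ⟪timeDerivWithin (Icc 0 t) u τ x, u τ x⟫)‖ₑ < ∞ := by
    have hslice : ∀ τ ∈ Ioo s₁ s₂,
        ∫⁻ x, ‖g (x 2) * (2 * ⟪timeDerivWithin (Icc 0 t) u τ x, u τ x⟫)‖ₑ ≤
          ENNReal.ofReal (∫ x : EuclideanSpace ℝ (Fin 3), A * (1 + ‖x‖) ^ (-(5 : ℝ))) := by
      intro τ hτ
      have hτ' : τ ∈ Icc 0 t := ⟨hs₁.trans hτ.1.le, hτ.2.le.trans hs₂⟩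
      rw [ofReal_integral_eq_lintegral_ofReal hBint (ae_of_all _ hBnn)]
      refine lintegral_mono fun x => ?_
      rw [← ofReal_norm]
      exact ENNReal.ofReal_le_ofReal (hdom τ hτ' x)
    calc ∫⁻ τ in Ioo s₁ s₂, ∫⁻ x, ‖g (x 2) * (2 * ⟪timeDerivWithin (Icc 0 t) u τ x, u τ x⟫)‖ₑ
        ≤ ∫⁻ _ in Ioo s₁ s₂, ENNReal.ofReal (∫ x : EuclideanSpace ℝ (Fin 3), A * (1 + ‖x‖) ^ (-(5 : ℝ))) :=
          setLIntegral_mono' measurableSet_Ioo hslice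
      _ < ∞ := by
          rw [setLIntegral_const, Real.volume_Ioo]
          exact ENNReal.mul_lt_top ENNReal.ofReal_lt_top ENNReal.ofReal_lt_top
  -- the end energies are integrable
  have hI : ∀ s ∈ Icc 0 t, Integrable fun x => g (x 2) * ‖u s x‖ ^ 2 := fun s hs' =>
    integrable_weight_mul (integrable_norm_sq (hcl.contDiff_velocity hs').continuous (h0 s hs')) hg hgK
  have key := integral_Ioo_integral_weight_mul_inner_timeDeriv hsm ht (continuous_weight hg) hs₁ hs hs₂
    hfin (hI s₁ ⟨hs₁, hs.trans hs₂⟩) (hI s₂ ⟨hs₁.trans hs, hs₂⟩)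
  rw [← key]
  refine setIntegral_congr_fun measurableSet_Ioo fun τ hτ => ?_
  have hτ' : τ ∈ Icc 0 t := ⟨hs₁.trans hτ.1.le, hτ.2.le.trans hs₂⟩
  simp_rw [timeDerivWithin_eq_acc hcl hτ']

/-- **Time-integrated weighted energy along a classical solution, registered form** (sub-goal
`timeIntegratedWeightedEnergy` of stmt-NavierStokesRegularity-16855; the time side of the flux
ledger and of the mild slab law): under order-(3,2) decay on `[0,t]`,
`∫_{(s₁,s₂)}∫ g(x₂)·2⟪νΔu − (u·∇)u − ∇p, u⟫ = ∫ g(x₂)|u(s₂)|² − ∫ g(x₂)|u(s₁)|²` for every bounded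
continuous weight `g` of the height. [folklore] -/
theorem timeIntegratedWeightedEnergy : ∀ (ν t : ℝ), 0 ≤ ν → 0 < t → ∀ (u : ℝ → EuclideanSpace ℝ (Fin 3) → EuclideanSpace ℝ (Fin 3)) (p : ℝ → EuclideanSpace ℝ (Fin 3) → ℝ), Literature.Analysis.FluidPDE.IsClassicalNSSolutionOn (Set.Icc 0 t) ν 0 u p → ∀ (C : ℝ), (∀ s ∈ Set.Icc 0 t, ∀ x, ‖u s x‖ ≤ C * (1 + ‖x‖) ^ (-(3 : ℝ))) → (∀ s ∈ Set.Icc 0 t, ∀ x, ‖fderiv ℝ (u s) x‖ ≤ C * (1 + ‖x‖) ^ (-(3 : ℝ))) → (∀ s ∈ Set.Icc 0 t, ∀ x, ‖iteratedFDeriv ℝ 2 (u s) x‖ ≤ C * (1 + ‖x‖) ^ (-(3 : ℝ))) → (∀ s ∈ Set.Icc 0 t, ∀ x, ‖gradient (p s) x‖ ≤ C * (1 + ‖x‖) ^ (-(2 : ℝ))) → ∀ (g : ℝ → ℝ) (K : ℝ), Continuous g → (∀ z, |g z| ≤ K) → ∀ (s₁ s₂ : ℝ), 0 ≤ s₁ →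 s₁ ≤ s₂ → s₂ ≤ t → ∫ s in Set.Ioo s₁ s₂, ∫ x, g (x 2) * (2 * inner ℝ (ν • Laplacian.laplacian (u s) x - Literature.Analysis.FluidPDE.convect (u s) (u s) x - gradient (p s) x) (u s x)) = (∫ x, g (x 2) * ‖u s₂ x‖ ^ 2) - ∫ x, g (x 2) * ‖u s₁ x‖ ^ 2 :=
  fun _ _ hν ht _ _ hcl _ h0 h1 h2 k1 _ _ hg hgK _ _ hs₁ hs hs₂ =>
    integral_Ioo_integral_weight_mul_two_inner_acc hν ht hcl h0 h1 h2 k1 hg hgK hs₁ hs hs₂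

end Summit.NavierStokesRegularity.NavierStokesRegularity.Theorems.PlanarEnergyAPriori

end
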